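import Mathlib
import Summits.KontsevichZagierPeriods.Zeta5Search.ZeroEvaluationProof
import HarnessLib

/-!
# ζ(5) search — the reflection symmetry of the partial fractions of `R_b`, and the harmonic sums at levels 0 and 1

Cell `pub-zeta5` (HONEST FRAMING: systematic search; no irrationality claim unless certified), P1 prover seat
generation 5; an ingredient of the Lean proof of census g11's `RecordCellA`.

* REFLECTION.  `R_b(y)` is odd under the well-poised reflection `y ↦ −y − b₀` (`DualSeries.numPoly_reflect`), hence its
  partial-fraction data are reflected with alternating signs: **`c_{o, b₀−q} = (−1)^o · c_{o,q}`** (`pfData_reflect`; via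
  `isPFData_reflect` and the uniqueness `IsPFData.eq`).  In particular the ζ(3)-pieces of conjugate classes agree and the
  constant-term pieces are related position by position.
* HARMONIC SUMS.  `H_q^{(i)} = Σ_{k ≤ q} k^{−i}` (`BallRivoal.harm i q`) is `p`-integral for `q < p` (`padicNorm_harm_le_one`)
  and equals `p^{−i}` up to a `p`-integral remainder for `p ≤ q < 2p` (`padicNorm_harm_sub_le_one`); in the normalised form
  used by the digit computations, `‖p^i·H_q^{(i)} − 1‖_p ≤ p⁻¹` there (`padicNorm_pow_mul_harm_sub_one_le`).
Identities and `p`-adic norms of rational numbers; nothing about irrationality.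
-/

noncomputable section

open Finset Polynomial

namespace Summit.KontsevichZagierPeriods.Zeta5Search.CellA

open Summit.KontsevichZagierPeriods.Zeta5Search.DualSeries (InBox numPoly numPoly_reflect)
open Summit.KontsevichZagierPeriods.Zeta5Search.WedgeDictionary (IsPFData pfData isPFData_pfData exists_isPFData)
open Summit.KontsevichZagierPeriods.Zeta5Search.CasoratianValuation (InPolytope)
open Summit.KontsevichZagierPeriods.Zeta5Search.ClusterValuation
open Summit.KontsevichZagierPeriods.Zeta5Search.PadicSeries
open Literature.NumberTheory.Transcendental.BallRivoal (pfEval harm poch poch_reflect)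

/-! ### Reflection of partial-fraction data -/

/-- One reflected term: `(−1)^o · c / (−x)^{o+1} = −(c / x^{o+1})`. -/
theorem neg_one_pow_mul_div_neg_pow (c x : ℚ) (o : ℕ) :
    (-1 : ℚ) ^ o * c / (-x) ^ (o + 1) = -(c / x ^ (o + 1)) := by
  rw [neg_pow x, pow_succ (-1 : ℚ) o]
  rcases Nat.even_or_odd o with he | ho
  · rw [he.neg_one_pow]; ring
  · rw [ho.neg_one_pow]; ring

/-- **Reflected data are data**: if `c` is partial-fraction data of `R_b` then so is `(o,q) ↦ (−1)^o c_{o, b₀−q}`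
(oddness of `R_b` under `y ↦ −y − b₀`). -/
theorem isPFData_reflect (b : ℕ → ℤ) (hbox : InBox b) {c : ℕ → ℕ → ℚ} (hc : IsPFData b c) :
    IsPFData b (fun o q => (-1 : ℚ) ^ o * c o ((b 0).toNat - q)) := by
  intro t ht
  set n := (b 0).toNat with hn
  set t' : ℚ := -t - n - 2 with ht'
  have hcast : ∀ q, q ≤ n → ((n - q : ℕ) : ℚ) = (n : ℚ) - q := fun q hq => by push_cast [Nat.cast_sub hq]; ring
  have ht'pole : ∀ q, q ≤ n → t' + q + 1 ≠ 0 := by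
    intro q hq h
    apply ht (n - q) (by omega)
    rw [hcast q hq]
    have : t + ((n : ℚ) - q) + 1 = -(t' + q + 1) := by rw [ht']; ring
    rw [this, h, neg_zero]
  -- the left-hand side is `−pfEval c t'`
  have hL : pfEval n 6 (fun o q => (-1 : ℚ) ^ o * c o (n - q)) t = -pfEval n 6 c t' := by
    unfold pfEval
    set F : ℕ → ℚ := fun q => ∑ o ∈ range 6, (-1 : ℚ) ^ o * c o q / (t + ((n - q : ℕ) : ℚ) + 1) ^ (o + 1)
      with hF
    have h1 : ∀ q ∈ range (n + 1),
        (∑ o ∈ range 6, (-1 : ℚ) ^ o * c o (n - q) / (t + q + 1) ^ (o + 1)) = F (n + 1 - 1 - q) := by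
      intro q hq
      have hq' : q ≤ n := Nat.lt_succ_iff.1 (mem_range.1 hq)
      have e1 : n + 1 - 1 - q = n - q := by omega
      have e2 : ((n - (n - q) : ℕ) : ℚ) = q := by rw [Nat.sub_sub_self hq']
      rw [hF, e1]
      simp only [e2]
    rw [sum_congr rfl h1, sum_range_reflect F (n + 1), ← sum_neg_distrib]
    refine sum_congr rfl fun q hq => ?_
    have hq' : q ≤ n := Nat.lt_succ_iff.1 (mem_range.1 hq)
    rw [hF, ← sum_neg_distrib]
    refine sum_congr rfl fun o _ => ?_
    rw [hcast q hq', show t + ((n : ℚ) - q) + 1 = -(t' + q + 1) by rw [ht']; ring]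
    exact neg_one_pow_mul_div_neg_pow _ _ _
  -- the right-hand side at `t'`
  have hR := hc t' ht'pole
  have hev : ((numPoly b).comp (X + C 1)).eval t' = -((numPoly b).comp (X + C 1)).eval t := by
    have h := congrArg (fun P => P.eval (t + 1)) (numPoly_reflect b hbox)
    simp only [eval_comp, eval_sub, eval_neg, eval_natCast, eval_X, eval_mul, eval_pow, eval_one,
      eval_add, eval_C] at h ⊢
    rw [Odd.neg_one_pow ⟨3 * (n + 1), by rw [hn]; ring⟩, neg_one_mul] at h
    rw [← h, ht']
    congr 1; ring
  have hpo : poch (t' + 1) (n + 1) ^ 6 = poch (t + 1) (n + 1) ^ 6 := by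
    have h := poch_reflect (t + 1) (n + 1)
    have e : -(t + 1) - ((n + 1 : ℕ) : ℚ) + 1 = t' + 1 := by rw [ht']; push_cast; ring
    rw [e] at h
    rw [h, mul_pow, ← pow_mul]
    have : ((-1 : ℚ)) ^ ((n + 1) * 6) = 1 := Even.neg_one_pow ⟨(n + 1) * 3, by ring⟩
    rw [this, one_mul]
  rw [hL, hR, hev, hpo, neg_div, neg_neg]

/-- **REFLECTION of the canonical coefficients**: `c_{o, b₀−q} = (−1)^o · c_{o,q}` for `b` in the polytope, `q ≤ b₀`, `o < 6`. -/
theorem pfData_reflect (b : ℕ → ℤ) (hb : InPolytope b) {q o : ℕ} (hq : q ≤ (b 0).toNat) (ho : o < 6) :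
    pfData b o ((b 0).toNat - q) = (-1 : ℚ) ^ o * pfData b o q := by
  obtain ⟨hbox, h2, h3⟩ := hb
  obtain ⟨c, hc⟩ := exists_isPFData b hbox (by omega)
  have hpf : IsPFData b (pfData b) := isPFData_pfData hc
  have h := (isPFData_reflect b hbox hpf).eq hpf ho hq
  have hsq : ((-1 : ℚ)) ^ o * (-1) ^ o = 1 := by rw [← pow_add, ← two_mul, pow_mul]; norm_num
  calc pfData b o ((b 0).toNat - q) = (-1 : ℚ) ^ o * ((-1 : ℚ) ^ o * pfData b o ((b 0).toNat - q)) := by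
        rw [← mul_assoc, hsq, one_mul]
    _ = (-1 : ℚ) ^ o * pfData b o q := by rw [h]

/-! ### Harmonic sums at levels 0 and 1 -/

variable {p : ℕ} [hp : Fact p.Prime]

/-- **Level 0**: `H_q^{(i)}` is `p`-integral for `q < p`. -/
theorem padicNorm_harm_le_one {q : ℕ} (hq : q < p) (i : ℕ) : padicNorm p (harm i q) ≤ 1 := by
  unfold harm
  refine padicNorm.sum_le' (fun m hm => ?_) zero_le_one
  have hm' := mem_range.1 hm
  have hnd : ¬ p ∣ m + 1 := fun h => by have := Nat.le_of_dvd (by omega) h; omega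
  have := padicNorm_inv_pow_le_one (p := p) hnd i
  simpa using this

/-- **Level 1**: `H_q^{(i)} − p^{−i}` is `p`-integral for `p ≤ q < 2p` (the only multiple of `p` up to `q` is `p`). -/
theorem padicNorm_harm_sub_le_one {q : ℕ} (hpq : p ≤ q) (hq2 : q < 2 * p) (i : ℕ) :
    padicNorm p (harm i q - 1 / (p : ℚ) ^ i) ≤ 1 := by
  have hmem : p - 1 ∈ range q := mem_range.2 (by have := hp.out.one_lt; omega)
  have hsplit := add_sum_erase (range q) (fun m : ℕ => 1 / ((m : ℚ) + 1) ^ i) hmem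
  have hp1 : (((p - 1 : ℕ) : ℚ) + 1) = p := by
    have := hp.out.one_lt
    push_cast [Nat.cast_sub this.le]; ring
  have e : harm i q - 1 / (p : ℚ) ^ i = ∑ m ∈ (range q).erase (p - 1), 1 / ((m : ℚ) + 1) ^ i := by
    rw [harm, ← hsplit, hp1]; ring
  rw [e]
  refine padicNorm.sum_le' (fun m hm => ?_) zero_le_one
  have hm' := mem_erase.1 hm
  have hmq := mem_range.1 hm'.2
  have hnd : ¬ p ∣ m + 1 := by
    rintro ⟨k, hk⟩
    have hk1 : k = 1 := by
      rcases Nat.lt_trichotomy k 1 with h0 | h1 | h2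
      · have : k = 0 := by omega
        subst this; omega
      · exact h1
      · have : p * 2 ≤ p * k := Nat.mul_le_mul_left p h2
        omega
    subst hk1
    exact hm'.1 (by omega)
  have := padicNorm_inv_pow_le_one (p := p) hnd i
  simpa using this

/-- `‖p^i‖_p = (p^i)⁻¹`. -/
theorem padicNorm_p_pow (i : ℕ) : padicNorm p ((p : ℚ) ^ i) = ((p : ℚ) ^ i)⁻¹ := by
  induction i with
  | zero => simp
  | succ k ih => rw [pow_succ, padicNorm.mul, ih, padicNorm.padicNorm_p_of_prime, mul_inv]

/-- `(p^i)⁻¹ ≤ p⁻¹ = p^{(−1)}` for `i ≥ 1`. -/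
theorem inv_p_pow_le {i : ℕ} (hi : 1 ≤ i) : ((p : ℚ) ^ i)⁻¹ ≤ (p : ℚ) ^ (-(1 : ℤ)) := by
  rw [zpow_neg, zpow_one]
  have hp1 : (1 : ℚ) ≤ p := one_le_p
  have hppos : (0 : ℚ) < p := by linarith
  exact inv_anti₀ hppos (by simpa using pow_le_pow_right₀ hp1 hi)

/-- **Level 1, normalised**: `‖p^i · H_q^{(i)} − 1‖_p ≤ p⁻¹` for `p ≤ q < 2p`, `i ≥ 1`. -/
theorem padicNorm_pow_mul_harm_sub_one_le {q : ℕ} (hpq : p ≤ q) (hq2 : q < 2 * p) {i : ℕ} (hi : 1 ≤ i) :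
    padicNorm p ((p : ℚ) ^ i * harm i q - 1) ≤ (p : ℚ) ^ (-(1 : ℤ)) := by
  have hp0 : (p : ℚ) ≠ 0 := Nat.cast_ne_zero.2 hp.out.ne_zero
  have e : (p : ℚ) ^ i * harm i q - 1 = (p : ℚ) ^ i * (harm i q - 1 / (p : ℚ) ^ i) := by
    field_simp
  rw [e, padicNorm.mul, padicNorm_p_pow]
  calc ((p : ℚ) ^ i)⁻¹ * padicNorm p (harm i q - 1 / (p : ℚ) ^ i) ≤ ((p : ℚ) ^ i)⁻¹ * 1 :=
        mul_le_mul_of_nonneg_left (padicNorm_harm_sub_le_one hpq hq2 i) (inv_nonneg.2 (pow_nonneg (Nat.cast_nonneg _) _))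
    _ ≤ (p : ℚ) ^ (-(1 : ℤ)) := by rw [mul_one]; exact inv_p_pow_le hi

/-- **Level 0, normalised**: `‖p^i · H_q^{(i)}‖_p ≤ p⁻¹` for `q < p`, `i ≥ 1`. -/
theorem padicNorm_pow_mul_harm_le {q : ℕ} (hq : q < p) {i : ℕ} (hi : 1 ≤ i) :
    padicNorm p ((p : ℚ) ^ i * harm i q) ≤ (p : ℚ) ^ (-(1 : ℤ)) := by
  rw [padicNorm.mul, padicNorm_p_pow]
  calc ((p : ℚ) ^ i)⁻¹ * padicNorm p (harm i q) ≤ ((p : ℚ) ^ i)⁻¹ * 1 :=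
        mul_le_mul_of_nonneg_left (padicNorm_harm_le_one hq i) (inv_nonneg.2 (pow_nonneg (Nat.cast_nonneg _) _))
    _ ≤ (p : ℚ) ^ (-(1 : ℤ)) := by rw [mul_one]; exact inv_p_pow_le hi

end Summit.KontsevichZagierPeriods.Zeta5Search.CellA

end
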